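import Summits.BirchSwinnertonDyer.Rank1Residual.Additive.CensusX42ValBridges
import Summits.BirchSwinnertonDyer.Rank1Residual.Additive.GordChiBranchKatoComponent
import Summits.BirchSwinnertonDyer.Rank1Residual.AdditivePotMult.PStarTwistModel
import HarnessLib

/-!
# Census relation X4-2 at WINDOW grade, V: the CONVERSE — Schneider + p01's typed branch `p`-adic
# Gross–Zagier ⟹ `CensusX42.ValRelationAt` (cell `b2b-bsdres`, census cell `bsd-formula-census`,
# seat `b2b-bsdres-census-ctyper1` = conjecture-typer 1, gen 6; sibling of `CensusX42ValRelation.lean`)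

HONEST FRAMING (cell `b2b-bsdres`, run/shared/lean/b2b/bsd-rank1-residual/, verbatim in every
file): the goal of the cell is to DELETE the COMBINATION-SHAPED residual classes of the
Birch–Swinnerton-Dyer formula for ALL analytic-rank `≤ 1` elliptic curves over `ℚ` — "full BSD
formula for every rank `≤ 1` curve in class `C`" assembled STRICTLY from published theorems — so
that the rank-`≤ 1` remainder becomes exactly the CONSTRUCTION-SHAPED classes, which are TYPED
(missing-input `Prop`s), NOT attempted. This is not "finishing BSD". Census cell
(bsd-formula-census): research instrumentation; census output = EVIDENCE / conjecture items, never a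
Literature fact; labels / RESIDUAL-MAP marks UNCHANGED (O7-ord OPEN; X3♯ / X4♯ CONSTRUCTION-SHAPED);
nothing booked. THEOREMS ONLY (no definition, no named fact); modularity `hmod`, Gross–Zagier I.(7.3)
`hGZ`, GZK `hGZK` enter as HYPOTHESES; the typed inputs `BranchPAdicGrossZagier[∅|Odd|Mult]At W p Dh`
(n1011-p01, `@[conjecture]`) and `SchneiderConjecture Dh` are HYPOTHESES here — the file proves an
implication between typed predicates, nothing about any curve.

## What

`CensusX42ValRelation` / `CensusX42ValBridges` proved: the VALUATION relation `ValRelationAt W p Dh`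
at the pair ⟹ `SchneiderConjecture Dh` and the parity- and locus-appropriate typed branch `p`-adic
Gross–Zagier of seat p01 (rows with a semistable quadratic twist). This file proves the CONVERSE on
the two loci, so that on every semistable-twist rank-one row of O7-ord the typed WINDOW relation is
EXACTLY p01's typed input plus the Schneider rider — nothing more, nothing less:

* §1 (G-ord): `valRelationAt_of_schneider_of_branchPAdicGrossZagier` — for `W` additive of type
  (G)-ordinary at the odd prime `p` (so `0 ≤ ord_p j(E)`: every twist model is potentially good and
  the (M)-clauses of `ValRelationAt` are vacuous, `not_mult_of_model_twist_of_padicValRat_j_nonneg`),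
  `r_an = 1`: `SchneiderConjecture Dh` ∧ (`p ≡ 1 (4)` → `BranchPAdicGrossZagierAt W p Dh`) ∧
  (`p ≡ 3 (4)` → `BranchPAdicGrossZagierOddAt W p Dh`) ⟹ `ValRelationAt W p Dh`
  (clause `L(0) = 0` from gen 2's `constantCoeff_[minus]branch_eq_zero_of_good`; `[T¹]L ≠ 0` from
  `Reg_p ≠ 0`, `u ≠ 0`, `q ≠ 0`; the norm clause from `ϖ·[T¹]L·log_p γ = u·q·Reg_p` with `‖u‖ = 1`
  and `q = s·∏c/#T²`, `s = #Ш_an`), and the iff `valRelationAt_iff_schneider_and_branchPAdicGrossZagier`;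
* §2 (M): `valRelationAt_of_schneider_of_branchPAdicGrossZagierMult` — for `W` potentially
  multiplicative (`AdditivePotMult.PotMult W p`: every twist model by `p*` is multiplicative,
  `PotMult.mult_of_twist_model_pStar`, so the (G)-clauses are vacuous):
  `SchneiderConjecture Dh` ∧ `BranchPAdicGrossZagierMultAt W p Dh` ⟹ `ValRelationAt W p Dh`, and the iff
  `valRelationAt_iff_schneider_and_branchPAdicGrossZagierMult`.
* §3 THE LOOP CLOSED at WINDOW grade: `ClassX4Gord.bsdp_iff_forall_censusX42Val_of_chiBranchLower_of_katoHalf`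
  and `ClassX4M.bsdp_iff_forall_censusX42Val_of_quadraticBranchLower_of_katoHalf` — on p01's IMC-version
  rows, GIVEN the rider, `BSD(E,p) ⟺ ∀ Dh, LeadingTermClauses → ValRelationAt W p Dh`.

KERNEL READING (no booking): with p01's loops (`BranchPAdicGrossZagierIff.lean`: on the IMC-version
rows `BSD(E,p)` ⟺ the typed branch `p`-adic GZ for every (B)-datum, given the rider), the typed WINDOW
relation `∀ Dh, LeadingTermClauses → ValRelationAt W p Dh` is thereby EQUIVALENT to `BSD(E,p)` on
those rows under the same side conditions — the census's valuations-only certificate measures exactly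
the kernel's open input, no surplus. EVIDENCE-conditional; nothing asserted about any curve.

References: B. Mazur, J. Tate, J. Teitelbaum, Invent. Math. 84 (1986) §I.10, §I.13
[MazurTateTeitelbaum1986Invent]; D. Delbourgo, Compositio Math. 113 (1998) §2.5 BS-D(p) (i)(ii)
[Delbourgo1998]; B. Gross, D. Zagier, Invent. Math. 84 (1986) Thm. I.(7.3) [GrossZagier1986];
P. Schneider, Invent. Math. 69 (1982) §1 [Schneider1982PadicHeightI]; J. Silverman, AEC (2009)
VII.5.1 [SilvermanAEC2009]; R. L. Miller, LMS J. Comput. Math. 14 (2011) Def. 1.1 [Miller2011LMS].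
-/

set_option autoImplicit false

noncomputable section

open scoped Classical MatrixGroups ModularForm NumberField

open CongruenceSubgroup WeierstrassCurve NumberField Literature.NumberTheory.EllipticCurves
  Literature.NumberTheory.EllipticCurves.ModularForms
  Literature.NumberTheory.EllipticCurves.Rank1Residual
  Literature.NumberTheory.EllipticCurves.Rank1Residual.Typed
  Literature.NumberTheory.EllipticCurves.Delbourgo2002
  Literature.NumberTheory.GaloisRepresentations
  Literature.Barriers.BirchSwinnertonDyer
  IsDedekindDomain

namespace Summit.BirchSwinnertonDyer.Rank1Residual.Additive

namespace CensusX42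

variable {p : ℕ} [hp : Fact p.Prime]

/-! ### §0 Bookkeeping -/

omit hp in
/-- A unit of `ℤ_p` has norm `1` in `ℚ_p`. [folklore] -/
private theorem norm_units_coe [Fact p.Prime] (u : ℤ_[p]ˣ) : ‖((u : ℤ_[p]) : ℚ_[p])‖ = 1 := by
  rw [PadicInt.padic_norm_e_of_padicInt]; exact PadicInt.isUnit_iff.mp u.isUnit

/-- With `#Ш_an = s` and `L'(E,1) = q·Ω_E·Reg_∞`: `s = q·#T²/∏c`. [cite: Miller2011LMS, Def. 1.1] -/
private theorem sha_literal_eq {W : WeierstrassCurve ℚ} [W.IsElliptic] {s q : ℚ}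
    (hs : shaAn W = (s : ℂ))
    (hLq : W.leadingLCoeff = (q : ℂ) * (W.realPeriodRat : ℂ) * (W.regulator : ℂ)) :
    s = q * (W.torsionOrder : ℚ) ^ 2 / W.tamagawaProduct := by
  have h := shaAn_eq_of_leadingLCoeff_eq W hLq
  rw [hs] at h
  exact_mod_cast h

/-- The three clauses of `ValRelationAt` for one branch series `B`, from an "up to a unit" identity
`ϖ·[T¹]B·log_p γ = u·q·Reg_p` (`u ∈ ℤ_p^×`), `Reg_p ≠ 0`, `s ≠ 0`, `s = q·#T²/∏c` and `B(0) = 0`.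
[folklore] -/
private theorem clauses_of_unit_identity {W : WeierstrassCurve ℚ} [W.IsElliptic]
    (Dh : PAdicHeightData W p) {B : PowerSeries ℚ_[p]} {ϖ s q : ℚ} {u : ℤ_[p]ˣ}
    (h0 : PowerSeries.constantCoeff B = 0)
    (hid : ((ϖ : ℚ) : ℚ_[p]) * PowerSeries.coeff 1 B * padicLog p (cyclotomicGenerator p) =
      ((u : ℤ_[p]) : ℚ_[p]) * (q : ℚ_[p]) * padicRegulator Dh)
    (hR : padicRegulator Dh ≠ 0) (hs0 : s ≠ 0)
    (hsq : s = q * (W.torsionOrder : ℚ) ^ 2 / W.tamagawaProduct) :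
    PowerSeries.constantCoeff B = 0 ∧ PowerSeries.coeff 1 B ≠ 0 ∧
      ‖(ϖ : ℚ_[p]) * PowerSeries.coeff 1 B * padicLog p (cyclotomicGenerator p) *
          (W.torsionOrder : ℚ_[p]) ^ 2‖ =
        ‖(s : ℚ_[p]) * padicRegulator Dh * W.tamagawaProduct‖ := by
  have hTq : (W.torsionOrder : ℚ) ≠ 0 := by exact_mod_cast (W.torsionOrder_pos_holds).ne'
  have hPq : (W.tamagawaProduct : ℚ) ≠ 0 := by
    exact_mod_cast (W.tamagawaProduct_pos_holds : 0 < W.tamagawaProduct).ne'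
  have hT : (W.torsionOrder : ℚ_[p]) ≠ 0 := by exact_mod_cast (W.torsionOrder_pos_holds).ne'
  have hP : (W.tamagawaProduct : ℚ_[p]) ≠ 0 := by
    exact_mod_cast (W.tamagawaProduct_pos_holds : 0 < W.tamagawaProduct).ne'
  have hq0 : q ≠ 0 := by
    rintro rfl
    rw [zero_mul, zero_div] at hsq
    exact hs0 hsq
  have hu0 : ((u : ℤ_[p]) : ℚ_[p]) ≠ 0 := norm_pos_iff.mp (by rw [norm_units_coe]; exact one_pos)
  have hq0' : (q : ℚ_[p]) ≠ 0 := by exact_mod_cast hq0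
  refine ⟨h0, ?_, ?_⟩
  · intro hc
    rw [hc, mul_zero, zero_mul] at hid
    exact mul_ne_zero (mul_ne_zero hu0 hq0') hR hid.symm
  · have h1 : (ϖ : ℚ_[p]) * PowerSeries.coeff 1 B * padicLog p (cyclotomicGenerator p) *
        (W.torsionOrder : ℚ_[p]) ^ 2 =
        ((u : ℤ_[p]) : ℚ_[p]) * ((q : ℚ_[p]) * padicRegulator Dh * (W.torsionOrder : ℚ_[p]) ^ 2) := by
      rw [hid]; ring
    have h2 : (s : ℚ_[p]) * padicRegulator Dh * W.tamagawaProduct =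
        (q : ℚ_[p]) * padicRegulator Dh * (W.torsionOrder : ℚ_[p]) ^ 2 := by
      rw [hsq]; push_cast; field_simp
    rw [h1, h2, norm_mul, norm_units_coe, one_mul]

/-! ### §1 (G)-ordinary rows: Schneider + the even/odd typed branch `p`-adic GZ ⟹ the valuation relation -/

/-- **CONVERSE on (G-ord) rows.** For `W = E` globally minimal of type (G)-ordinary at the odd
prime `p` (`TypeGOrd`, `Addv`), `r_an = 1`, and a height datum `Dh`: the Schneider rider together with
p01's typed branch `p`-adic Gross–Zagier of the parity of `(p−1)/2` (`BranchPAdicGrossZagierAt` at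
`p ≡ 1`, `BranchPAdicGrossZagierOddAt` at `p ≡ 3 (mod 4)`) IMPLY `ValRelationAt W p Dh`: every twist
model of a potentially good `W` is potentially good, so the (M)-clauses are vacuous; on a good
ORDINARY model the identity `ϖ·[T¹]L·log_p γ = u·q·Reg_p` (`u ∈ ℤ_p^×`, `q = #Ш_an·∏c/#T²`) gives the
norm clause and `[T¹]L ≠ 0`, and `L(0) = 0` is gen 2's theorem. [cite: MazurTateTeitelbaum1986Invent, §I.13]
[cite: SilvermanAEC2009, VII.5 Prop. 5.1(b)] [cite: GrossZagier1986, Thm. I.(7.3)] -/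
theorem valRelationAt_of_schneider_of_branchPAdicGrossZagier (hGZ : GrossZagier1986_thm_I_7_3)
    (hGZK : rank_eq_analyticRank_of_analyticRank_le_one) (hmod : hasEntireLFunction_rat)
    {W : WeierstrassCurve ℚ} [W.IsElliptic] [W.IsGloballyMinimal] (hG : TypeGOrd W p)
    (hr : W.analyticRank = 1) {Dh : PAdicHeightData W p} (hS : SchneiderConjecture Dh)
    (hE : p % 4 = 1 → BranchPAdicGrossZagierAt W p Dh)
    (hO : p % 4 = 3 → BranchPAdicGrossZagierOddAt W p Dh) : ValRelationAt W p Dh := by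
  intro V _ _ C N _ f hadd hV hf _ s hs
  have hj := padicValRat_j_nonneg_of_typeGOrd W p hG
  have hrk : W.mordellWeilRank = 1 := by rw [(hGZK W hr.le).1, hr]
  have hr0 : W.analyticRank ≠ 0 := by rw [hr]; exact one_ne_zero
  obtain ⟨s₀, hs₀0, hs₀⟩ := X11b.exists_rat_ne_zero_shaAn_eq_of_analyticRank_eq_one hGZ hGZK W hr
  have hs0 : s ≠ 0 := by
    have : s = s₀ := by exact_mod_cast hs.symm.trans hs₀
    rw [this]; exact hs₀0
  have hp0 : (p : ℚ) ≠ 0 := by exact_mod_cast hp.out.ne_zero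
  have hR : padicRegulator Dh ≠ 0 := hS
  refine ⟨fun h1 hC ϖ hϖ ↦ ⟨fun hord ↦ ?_, fun hmult ↦ ?_⟩, fun h3 hC ϖ hϖ ↦ ⟨fun hord ↦ ?_, fun hmult ↦ ?_⟩⟩
  · -- even branch, good ordinary model
    obtain ⟨u, q, hLq, hid⟩ := hE h1 V h1 ⟨C, hC⟩ hord hf ϖ hϖ
    rw [hrk, pow_one] at hid
    exact clauses_of_unit_identity Dh
      (constantCoeff_branch_eq_zero_of_good p hmod h1 V W C hC hord hadd hf ϖ hϖ hr0) hid hR hs0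
      (sha_literal_eq hs hLq)
  · exact absurd hmult (not_mult_of_model_twist_of_padicValRat_j_nonneg W V hp0 ⟨C, hC⟩ hj)
  · -- odd branch, good ordinary model
    obtain ⟨u, q, hLq, hid⟩ := hO h3 V h3 ⟨C, hC⟩ hord hf ϖ hϖ
    rw [hrk, pow_one] at hid
    exact clauses_of_unit_identity Dh
      (constantCoeff_minusBranch_eq_zero_of_good p hmod h3 V W C hC hord hadd hf ϖ hϖ hr0) hid hR hs0
      (sha_literal_eq hs hLq)
  · exact absurd hmult
      (not_mult_of_model_twist_of_padicValRat_j_nonneg W V (neg_ne_zero.mpr hp0) ⟨C, hC⟩ hj)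

/-- **(G-ord, `e = 2`) rows: the typed WINDOW relation IS p01's typed input + the Schneider rider**
(iff; `→` by `CensusX42ValRelation` / `CensusX42ValBridges`, which need the twist model — hence the
defect-2 hypothesis `he` and modular parametrisations `hmodD`). [cite: MazurTateTeitelbaum1986Invent, §I.13]
[cite: GrossZagier1986, Thm. I.(7.3)] -/
theorem valRelationAt_iff_schneider_and_branchPAdicGrossZagier (hGZ : GrossZagier1986_thm_I_7_3)
    (hGZK : rank_eq_analyticRank_of_analyticRank_le_one) (hmod : hasEntireLFunction_rat)
    (hmodD : nonempty_modularParametrizationData)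
    {W : WeierstrassCurve ℚ} [W.IsElliptic] [W.IsGloballyMinimal] (hp2 : p ≠ 2) (hG : TypeGOrd W p)
    (hadd : Addv W p) (he : semistabilityIndex W p = 2) (hr : W.analyticRank = 1)
    (Dh : PAdicHeightData W p) :
    ValRelationAt W p Dh ↔ SchneiderConjecture Dh ∧ (p % 4 = 1 → BranchPAdicGrossZagierAt W p Dh) ∧
      (p % 4 = 3 → BranchPAdicGrossZagierOddAt W p Dh) := by
  constructor
  · intro h
    exact ⟨schneider_of_valRelationAt hGZ hGZK hmodD hp2 hG hadd he hr h,
      fun _ ↦ branchPAdicGrossZagierAt_of_valRelationAt hGZ hGZK W hadd hr Dh h,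
      fun _ ↦ branchPAdicGrossZagierOddAt_of_valRelationAt hGZ hGZK W hadd hr Dh h⟩
  · rintro ⟨hS, hE, hO⟩
    exact valRelationAt_of_schneider_of_branchPAdicGrossZagier hGZ hGZK hmod hG hr hS hE hO


/-! ### §2 (M) rows: Schneider + the (M) typed branch `p`-adic GZ ⟹ the valuation relation -/

/-- **CONVERSE on (M) rows.** For `W = E` globally minimal, additive and potentially MULTIPLICATIVE at
`p` (`AdditivePotMult.PotMult W p`), `r_an = 1`, and a height datum `Dh`: the Schneider rider together
with p01's typed (M)-branch `p`-adic Gross–Zagier `BranchPAdicGrossZagierMultAt W p Dh` IMPLY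
`ValRelationAt W p Dh`: every twist model by `p*` is multiplicative (`PotMult.mult_of_twist_model_pStar`),
so the (G)-clauses are vacuous; on the multiplicative model `ã = a_p(V) = ±1` selects p01's disjunct, the
identity `ϖ·[T¹]L^{±}·log_p γ = u·q·Reg_p` gives the norm clause and `[T¹]L ≠ 0`, and `L(0) = 0` is gen
2's theorem. [cite: MazurTateTeitelbaum1986Invent, §I.10, §I.13] [cite: GrossZagier1986, Thm. I.(7.3)] -/
theorem valRelationAt_of_schneider_of_branchPAdicGrossZagierMult (hGZ : GrossZagier1986_thm_I_7_3)
    (hGZK : rank_eq_analyticRank_of_analyticRank_le_one) (hmod : hasEntireLFunction_rat)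
    {W : WeierstrassCurve ℚ} [W.IsElliptic] [W.IsGloballyMinimal] (hpm : AdditivePotMult.PotMult W p)
    (hr : W.analyticRank = 1) {Dh : PAdicHeightData W p} (hS : SchneiderConjecture Dh)
    (hM : BranchPAdicGrossZagierMultAt W p Dh) : ValRelationAt W p Dh := by
  intro V _ _ C N _ f hadd hV hf _ s hs
  have hrk : W.mordellWeilRank = 1 := by rw [(hGZK W hr.le).1, hr]
  have hr0 : W.analyticRank ≠ 0 := by rw [hr]; exact one_ne_zero
  obtain ⟨s₀, hs₀0, hs₀⟩ := X11b.exists_rat_ne_zero_shaAn_eq_of_analyticRank_eq_one hGZ hGZK W hr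
  have hs0 : s ≠ 0 := by
    have : s = s₀ := by exact_mod_cast hs.symm.trans hs₀
    rw [this]; exact hs₀0
  have hR : padicRegulator Dh ≠ 0 := hS
  obtain ⟨hsplit, hnonsplit⟩ := intCast_LFunction_eq_of_split_or_nonsplit (p := p) hf
  -- p01's disjunction for the one-term branch with parameter `ã = a_p(V)`
  have hB : ∀ hmult : Mult V p,
      (V.HasSplitMultiplicativeReductionAtPrime p ∧
        (if Even (p / 2) then padicLFunctionPlusBranchMult f ((V.LFunction p : ℤ) : ℚ_[p]) (p / 2)
          else padicLFunctionMinusBranchMult f ((V.LFunction p : ℤ) : ℚ_[p]) (p / 2)) =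
          if Even (p / 2) then padicLFunctionPlusBranchMult f (1 : ℚ_[p]) (p / 2)
          else padicLFunctionMinusBranchMult f (1 : ℚ_[p]) (p / 2)) ∨
      (V.HasMultiplicativeReductionAtPrime p ∧ ¬ V.HasSplitMultiplicativeReductionAtPrime p ∧
        (if Even (p / 2) then padicLFunctionPlusBranchMult f ((V.LFunction p : ℤ) : ℚ_[p]) (p / 2)
          else padicLFunctionMinusBranchMult f ((V.LFunction p : ℤ) : ℚ_[p]) (p / 2)) =
          if Even (p / 2) then padicLFunctionPlusBranchMult f (-1 : ℚ_[p]) (p / 2)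
          else padicLFunctionMinusBranchMult f (-1 : ℚ_[p]) (p / 2)) := by
    intro hmult
    by_cases hsp : V.HasSplitMultiplicativeReductionAtPrime p
    · left; exact ⟨hsp, by rw [hsplit hsp, Int.cast_one]⟩
    · right; exact ⟨hmult, hsp, by rw [hnonsplit hmult hsp, Int.cast_neg, Int.cast_one]⟩
  refine ⟨fun h1 hC ϖ hϖ ↦ ?_, fun h3 hC ϖ hϖ ↦ ?_⟩
  · have hp2 : p ≠ 2 := by omega
    have hev : Even (p / 2) := ⟨p / 4, by omega⟩
    have hC' : C • V.quadraticTwist ((-1 : ℚ) ^ (p / 2) * p) = W := by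
      rw [pStar_eq_of_mod_four p (Or.inl h1), if_pos h1]; exact hC
    have hmult : Mult V p := hpm.mult_of_twist_model_pStar hp2 V C hC'
    refine ⟨fun hord ↦ absurd hord.1
      (not_hasGoodReductionAtPrime_of_hasMultiplicativeReductionAtPrime p hmult), fun _ ↦ ?_⟩
    obtain ⟨u, q, hLq, hid⟩ := hM V _ hp2 ⟨C, hC'⟩ (hB hmult) hf ϖ (by rw [if_pos hev]; exact hϖ)
    rw [hrk, pow_one, if_pos hev] at hid
    exact clauses_of_unit_identity Dh
      (constantCoeff_branchMult_eq_zero p hmod h1 V W C hC hmult hadd hf ϖ hϖ hr0) hid hR hs0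
      (sha_literal_eq hs hLq)
  · have hp2 : p ≠ 2 := by omega
    have hnev : ¬ Even (p / 2) := by rw [Nat.not_even_iff_odd]; exact ⟨p / 4, by omega⟩
    have hC' : C • V.quadraticTwist ((-1 : ℚ) ^ (p / 2) * p) = W := by
      rw [pStar_eq_of_mod_four p (Or.inr h3), if_neg (by omega)]; exact hC
    have hmult : Mult V p := hpm.mult_of_twist_model_pStar hp2 V C hC'
    refine ⟨fun hord ↦ absurd hord.1
      (not_hasGoodReductionAtPrime_of_hasMultiplicativeReductionAtPrime p hmult), fun _ ↦ ?_⟩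
    obtain ⟨u, q, hLq, hid⟩ := hM V _ hp2 ⟨C, hC'⟩ (hB hmult) hf ϖ (by rw [if_neg hnev]; exact hϖ)
    rw [hrk, pow_one, if_neg hnev] at hid
    exact clauses_of_unit_identity Dh
      (constantCoeff_minusBranchMult_eq_zero p hmod h3 V W C hC hmult hadd hf ϖ hϖ hr0) hid hR hs0
      (sha_literal_eq hs hLq)

/-- **(M) rows: the typed WINDOW relation IS p01's (M) typed input + the Schneider rider** (iff; `→`
by `CensusX42ValRelation` / `CensusX42ValBridges`). [cite: MazurTateTeitelbaum1986Invent, §I.10, §I.13]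
[cite: GrossZagier1986, Thm. I.(7.3)] -/
theorem valRelationAt_iff_schneider_and_branchPAdicGrossZagierMult (hGZ : GrossZagier1986_thm_I_7_3)
    (hGZK : rank_eq_analyticRank_of_analyticRank_le_one) (hmod : hasEntireLFunction_rat)
    (hmodD : nonempty_modularParametrizationData)
    {W : WeierstrassCurve ℚ} [W.IsElliptic] [W.IsGloballyMinimal] (hp2 : p ≠ 2)
    (hpm : AdditivePotMult.PotMult W p) (hr : W.analyticRank = 1) (Dh : PAdicHeightData W p) :
    ValRelationAt W p Dh ↔ SchneiderConjecture Dh ∧ BranchPAdicGrossZagierMultAt W p Dh :=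
  ⟨fun h ↦ ⟨schneider_of_valRelationAt_mult hGZ hGZK hmodD hp2 hpm hr h,
      branchPAdicGrossZagierMultAt_of_valRelationAt hGZ hGZK W hpm.1 hr Dh h⟩,
    fun h ↦ valRelationAt_of_schneider_of_branchPAdicGrossZagierMult hGZ hGZK hmod hpm hr h.1 h.2⟩


end CensusX42

/-! ### §3 THE LOOP CLOSED at WINDOW grade: `BSD(E,p)` ⟺ the typed WINDOW relation for every (B)-datum -/

open CensusX42

variable {p : ℕ} [hp : Fact p.Prime]

/-- **IMC-version rows, (G-ord, `e = 2`) ∩ {`ρ̄` onto}, `p ≡ 1 (mod 4)`, non-anomalous, `r_an = 1`:**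
GIVEN the even-branch IMC pieces (typed LOWER `hdiv` + Kato's half `hK`), Delbourgo 2002 (A)+(B),
modularity, GZ I.(7.3), GZK and the Schneider rider for every (B)-datum (`hSall`):
`BSD(E,p) ⟺ ∀ Dh, LeadingTermClauses → ValRelationAt W p Dh` — p01's loop
(`ClassX4Gord.bsdp_iff_forall_branchPAdicGrossZagierAt_of_chiBranchLower_of_katoHalf`) read through
§1's iff. The census's valuations-only WINDOW certificate measures exactly this right-hand side
(EVIDENCE; nothing booked). [cite: Delbourgo2002, Theorem (A), (B) (p. 40)]
[cite: Kato2004Asterisque, Thm. 17.4 (3) (p. 273)] [cite: GrossZagier1986, Thm. I.(7.3)] [cite: Miller2011LMS, Def. 1.1] -/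
theorem ClassX4Gord.bsdp_iff_forall_censusX42Val_of_chiBranchLower_of_katoHalf
    {W : WeierstrassCurve ℚ} [W.IsElliptic] [W.IsGloballyMinimal] (hDel : Delbourgo2002.mainTheorem)
    (hK : Wuthrich2014.kato_halfEigenCharIdeal_dvd_cyclotomicPrime_of_surjective)
    (hGZ : GrossZagier1986_thm_I_7_3) (hmod : hasEntireLFunction_rat)
    (hmodD : nonempty_modularParametrizationData) (hGZK : rank_eq_analyticRank_of_analyticRank_le_one)
    (hX : ClassX4Gord W p) (he : semistabilityIndex W p = 2) (hp4 : p % 4 = 1)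
    (hna : ReductionNonAnomalous W p) (hsurj : Surj W p) (hr : W.analyticRank = 1)
    (hdiv : ChiBranchLowerDivisibilityAt W p)
    (hSall : ∀ Dh : PAdicHeightData W p, LeadingTermClauses W p Dh → SchneiderConjecture Dh) :
    BSDp W p ↔ ∀ Dh : PAdicHeightData W p, LeadingTermClauses W p Dh → ValRelationAt W p Dh := by
  have hp5 : 5 ≤ p := by have := hp.out.two_le; omega
  refine ⟨fun hbsd Dh hB ↦ ?_, fun hrel ↦ ?_⟩
  · have hGZe := (hX.bsdp_iff_forall_branchPAdicGrossZagierAt_of_chiBranchLower_of_katoHalf hDel hK hmod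
      hmodD hGZK he hp4 (hX.not_hasCM_of_surj_of_five_le he hp5 hsurj) hna hsurj hr hdiv hSall).mp hbsd
    exact valRelationAt_of_schneider_of_branchPAdicGrossZagier hGZ hGZK hmod hX.typeGOrd hr (hSall Dh hB)
      (fun _ ↦ hGZe Dh hB) (fun h3 ↦ absurd h3 (by omega))
  · exact hX.bsdp_rankOne_of_chiBranchLower_of_katoHalf_of_forall_censusX42Val hDel hK hGZ hmod hmodD
      hGZK he hp4 hna hsurj hr hdiv hrel

end Summit.BirchSwinnertonDyer.Rank1Residual.Additive

namespace Summit.BirchSwinnertonDyer.Rank1Residual.AdditivePotMult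

open Additive CensusX42

variable {W : WeierstrassCurve ℚ} [W.IsElliptic] [W.IsGloballyMinimal] {p : ℕ} [hp : Fact p.Prime]

/-- **IMC-version rows on X4(M) ∩ {`ρ̄_{E,p}` onto}, EVERY odd `p`, `r_an = 1`:** GIVEN the (M)-branch
IMC pieces on `E♭` (p10's typed LOWER `hc` on every multiplicative twist model + Kato's half),
Delbourgo 2002 (M), modularity, GZ I.(7.3), GZK and the rider for every (B)-datum (`hSall`):
`BSD(E,p) ⟺ ∀ Dh, LeadingTermClauses → ValRelationAt W p Dh` — p01's (M) loop read through §2's iff.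
[cite: Delbourgo2002, Theorem (A), (B), Example (p. 40)] [cite: Kato2004Asterisque, Thm. 17.4 (3) (p. 273)]
[cite: GrossZagier1986, Thm. I.(7.3)] [cite: Miller2011LMS, Def. 1.1] -/
theorem ClassX4M.bsdp_iff_forall_censusX42Val_of_quadraticBranchLower_of_katoHalf
    (hDelM : Delbourgo2002.mainTheorem_potMult)
    (hK : Wuthrich2014.kato_halfEigenCharIdeal_dvd_cyclotomicPrime_of_surjective)
    (hGZ : GrossZagier1986_thm_I_7_3) (hmod : hasEntireLFunction_rat)
    (hmodD : nonempty_modularParametrizationData) (hGZK : rank_eq_analyticRank_of_analyticRank_le_one)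
    (hX : ClassX4M W p) (hsurj : Surj W p) (hr : W.analyticRank = 1)
    (hc : ∀ (V : WeierstrassCurve ℚ) [V.IsElliptic] [V.IsGloballyMinimal],
      (∃ C : VariableChange ℚ, C • V.quadraticTwist ((-1) ^ (p / 2) * p : ℚ) = W) →
        QuadraticBranchLowerDivisibilityAt V p)
    (hSall : ∀ Dh : PAdicHeightData W p, LeadingTermClauses W p Dh → SchneiderConjecture Dh) :
    BSDp W p ↔ ∀ Dh : PAdicHeightData W p, LeadingTermClauses W p Dh → ValRelationAt W p Dh := by
  refine ⟨fun hbsd Dh hB ↦ ?_, fun hrel ↦ ?_⟩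
  · have hGZm := (hX.bsdp_iff_forall_branchPAdicGrossZagierMultAt_of_quadraticBranchLower_of_katoHalf
      hDelM hK hmod hmodD hGZK hsurj hr hc hSall).mp hbsd
    exact valRelationAt_of_schneider_of_branchPAdicGrossZagierMult hGZ hGZK hmod (ClassX4M.potMult W p hX)
      hr (hSall Dh hB) (hGZm Dh hB)
  · exact hX.bsdp_rankOne_of_quadraticBranchLower_of_katoHalf_of_forall_censusX42Val hDelM hK hGZ hmod
      hmodD hGZK hsurj hr hc hrel

end Summit.BirchSwinnertonDyer.Rank1Residual.AdditivePotMult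

end
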